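import Summits.BirchSwinnertonDyer.Rank1Residual.Additive.ChiEigenPrimeToPDescentDual
import Summits.BirchSwinnertonDyer.Rank1Residual.AdditivePotMult.GeneratorNormalisation
import Literature.NumberTheory.EllipticCurves.SelmerPInftyRelModelAction
import Literature.NumberTheory.EllipticCurves.PAdicBSD
import Mathlib.NumberTheory.NumberField.Cyclotomic.Basic
import HarnessLib

/-!
# Generator normalisation into `Gal(ℚ̄/K·F)` for the `F`-level eigen datum, the cyclotomic case
# `F = ℚ(ζ_p)`, and the end-to-end packaging (cell `b2b-bsdres`, sub-cell additive-p2, gen 12;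
# sequel 2 of `ChiEigenPrimeToPDescent.lean`)

HONEST FRAMING (cell `b2b-bsdres`, run/shared/lean/b2b/bsd-rank1-residual/, verbatim in every
file): the goal of the cell is to DELETE the COMBINATION-SHAPED residual classes of the
Birch–Swinnerton-Dyer formula for ALL analytic-rank `≤ 1` elliptic curves over `ℚ` — "full BSD
formula for every rank `≤ 1` curve in class `C`" assembled STRICTLY from published theorems — so
that the rank-`≤ 1` remainder becomes exactly the CONSTRUCTION-SHAPED classes, which are TYPED
(missing-input `Prop`s), NOT attempted. This is not "finishing BSD". Sub-cell `additive-p2`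
(CLASS-OWNERS row "X3/X4 additive — pot. good ordinary / X3♯(G-ord)"), generation 12: research
route; no claim beyond the stated classes; X3♯(G-ord)/X4♯(G-ord) stay CONSTRUCTION-SHAPED; labels /
census / located gap UNCHANGED; nothing is booked. Theorems only (no definition, no named fact).

Context: `ChiEigenPrimeToPDescent.lean` (eigen-descent `Sel(E♭/K·ℚ_∞)^{(χ_K)} ≃ Sel(E♭/F·K·ℚ_∞)^{(χ_K)}`
for `p ∤ [Γ_ℚ : U]`, `F = ℚ̄^U`) and `ChiEigenPrimeToPDescentDual.lean` (the `Λ`-dual datum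
`ChiEigenSelmerInDualData V K κ U γ` and `SelmerDualData.toChiEigenIn`, same module). The printed
componentwise statements (Kato 2004 Thm. 17.4 (3) / Wuthrich 2014 Thm. 16 over
`F·ℚ_∞ = ℚ(μ_{p^∞})`) have their variable `T = γ_F − 1` with `γ_F ∈ Gal(ℚ̄/F)`; the consumer's `γ`
is an arbitrary topological generator in `Γ_ℚ`. This file:

* `Zp.eq_top_of_index_coprime` — a subgroup of `ℤ_p` of finite index prime to `p` is everything
  (generalising additive-p1's `eq_top_of_forall_sq_mem`);
* `map_galRange_inf_eq_top`, `exists_mul_mem_galRange_inf`, `exists_normalisedGenerator` — for `p`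
  odd and `p ∤ [Γ_ℚ : U]`, `κ` maps `Gal(ℚ̄/K) ⊓ U` ONTO `ℤ_p`, so every `γ ∈ Gal(ℚ̄/K)` has
  `γ g₀ ∈ Gal(ℚ̄/K) ⊓ U` with `g₀ ∈ ker κ ⊓ Gal(ℚ̄/K)` — which acts TRIVIALLY on the eigenspace
  (sign `+1`) — and `κ (γ g₀) = κ γ`; `IsTopGenerator` and (for `κ` cyclotomic)
  `IsCyclotomicVariable p` survive (`isTopGenerator_of_kappa_eq`,
  `isCyclotomicVariable_mul_of_mem_kerSubgroup`);
* `SelmerDualData.exists_chiEigenIn` — END TO END for general `U`: for EVERY `Λ`-dual datum `D` of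
  `Sel_{p^∞}(E/ℚ_∞)` (`E = E♭ ⊗ χ_K`, `p` odd, any `γ`) there are `γ' = γ g` (`g ∈ ker κ`) in
  `Gal(ℚ̄/K) ⊓ U` and an `F`-level eigen datum `D'` at `γ'` with `char_Λ D'.X = D.charIdeal` and the
  same torsion-ness (additive-p1's `exists_mul_mem_galRange`/`congrGen`/`toChiEigen`, then `toIn`,
  then the normalisation above);
* §6 `F = ℚ(ζ_p)`: `galRange F` normal of index `p − 1` prime to `p`
  (`normal_galRange_cyclotomic`, `index_galRange_cyclotomic`, `coprime_index_galRange_cyclotomic`),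
  hence **`SelmerDualData.exists_chiEigenInCyclotomic`**: every `D : W.SelmerDualData κ γ` yields a
  `Λ`-dual datum of `Sel_{p^∞}(E♭/F·K·ℚ_∞)^{(χ_K)}` (for `K = ℚ(√p*) ⊂ F`:
  `e_{(p−1)/2}·Sel_{p^∞}(E♭/ℚ(μ_{p^∞}))`) at a generator `γ' ∈ Gal(ℚ̄/K) ⊓ Gal(ℚ̄/F)` with the same
  characteristic ideal — the exact input slot of the componentwise reading-fact (brick 4′) at EVERY
  odd `p` (at `p = 3`, `F = K` and this is additive-p1's brick 4 slot).

What this does NOT do: the reading-fact itself (literature seat / referee, flag family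
`Kato-17.4-pgen-branch-split` / `Wu14-Thm16-pgen-branch-split`), the `T = 0` constant term and the
model/period bookkeeping of brick 5′, the LOWER (Eisenstein) half on the `ω^{(p−1)/2}`-branch (the
located gap). Labels UNCHANGED; nothing booked.

References: R. Greenberg, LNM 1716 (1999), §5 p. 143 [GreenbergLNM1716]; L. Washington,
*Introduction to Cyclotomic Fields*, §13.1 (`ℤ_p`-extensions; no subextension of degree prime to
`p`) [Washington1997]; K. Kato, Astérisque 295 (2004) §17.3, Thm. 17.4 [Kato2004Asterisque];
C. Wuthrich, Doc. Math. 19 (2014) §3, Thm. 16 [Wuthrich2014].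
-/

noncomputable section

open scoped Classical

namespace Summit.BirchSwinnertonDyer.Rank1Residual.Additive

open Literature.NumberTheory.EllipticCurves Literature.NumberTheory.GaloisRepresentations
  WeierstrassCurve Summit.BirchSwinnertonDyer.Rank1Residual.AdditivePotMult

/-! ## §0 A subgroup of `ℤ_p` of finite index prime to `p` is everything -/

section Zp

variable {p : ℕ} [Fact p.Prime]

/-- A subgroup of (multiplicative) `ℤ_p` of finite index `n` with `p ∤ n` is everything: `n`-th
powers lie in a subgroup of index `n`, and additively `x = n·(n⁻¹x)` with `n ∈ ℤ_pˣ`. (Field side: a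
`ℤ_p`-extension has no subextension of degree prime to `p`; Washington, *Introduction to Cyclotomic
Fields*, §13.1.) Generalises additive-p1's `eq_top_of_forall_sq_mem` (`n = 2`). [folklore] -/
theorem Zp.eq_top_of_index_coprime (S : Subgroup (Multiplicative ℤ_[p]))
    (hcop : S.index.Coprime p) : S = ⊤ := by
  have hndvd : ¬p ∣ S.index := fun h ↦ (Fact.out : p.Prime).ne_one
    (Nat.Coprime.eq_one_of_dvd (Nat.coprime_comm.mp hcop) h)
  have hu : IsUnit ((S.index : ℕ) : ℤ_[p]) :=
    IwasawaDual.isUnit_natCast_padicInt (p := p) (e := S.index) hndvd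
  obtain ⟨u, hu⟩ := hu
  rw [eq_top_iff]
  intro x _
  have hx : x = (Multiplicative.ofAdd (((u⁻¹ : ℤ_[p]ˣ) : ℤ_[p]) * Multiplicative.toAdd x)) ^ S.index := by
    apply Multiplicative.toAdd.injective
    rw [toAdd_pow, toAdd_ofAdd, nsmul_eq_mul, ← mul_assoc, ← hu, Units.mul_inv, one_mul]
  rw [hx]
  exact Subgroup.pow_index_mem S _

end Zp

/-! ## §5 Generator normalisation at `F`-level -/

section Gen

variable (K : Type) [Field K] [NumberField K] (h2 : Module.finrank ℚ K = 2) {θ : K} {c : ℚ}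
  (hθ : θ ∉ Set.range (algebraMap ℚ K)) (hc : θ ^ 2 = algebraMap ℚ K c) {p : ℕ} [Fact p.Prime]
  (κ : ZpExtension ℚ p) (U : Subgroup (Field.absoluteGaloisGroup ℚ)) [U.Normal]
  (hcop : U.index.Coprime p)

include h2 hθ hc hcop in
/-- `κ` maps `galRange K ⊓ U` ONTO `ℤ_p` for `p` odd, `U` open normal with `p ∤ [Γ_ℚ : U]`: the
image has finite index dividing `2·[Γ_ℚ : U]`, prime to `p` (§0). (Field side:
`K·F ∩ ℚ_∞ = ℚ`.) [folklore] -/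
theorem map_galRange_inf_eq_top (hp2 : p ≠ 2) :
    (galRange (K := ℚ) K ⊓ U).map κ.toContinuousMonoidHom.toMonoidHom = ⊤ := by
  haveI : IsGalois ℚ K := isGalois_of_finrank_eq_two K h2
  have hG : (galRange (K := ℚ) K).index = 2 := index_galRange K h2 (sigmaQ_ne_one K h2 hθ hc)
  -- `[Γ : G ⊓ U] = [G : G ⊓ U]·[Γ : G] = (U.relIndex G)·2` divides `2·[Γ : U]`
  have hidx : (galRange (K := ℚ) K ⊓ U).index = U.relIndex (galRange (K := ℚ) K) * 2 := by
    rw [← hG, ← Subgroup.relIndex_mul_index (inf_le_left : galRange (K := ℚ) K ⊓ U ≤ _),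
      Subgroup.inf_relIndex_left]
  have hdvdU : U.relIndex (galRange (K := ℚ) K) ∣ U.index := Subgroup.relIndex_dvd_index_of_normal U _
  have hcop' : (galRange (K := ℚ) K ⊓ U).index.Coprime p := by
    rw [hidx]
    exact Nat.Coprime.mul_left (Nat.Coprime.coprime_dvd_left hdvdU hcop)
      (Nat.coprime_two_left.mpr ((Fact.out : p.Prime).odd_of_ne_two hp2))
  have hmap : ((galRange (K := ℚ) K ⊓ U).map κ.toContinuousMonoidHom.toMonoidHom).index ∣
      (galRange (K := ℚ) K ⊓ U).index :=
    Subgroup.index_map_dvd _ κ.surjective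
  exact Zp.eq_top_of_index_coprime _ (Nat.Coprime.coprime_dvd_left hmap hcop')

include h2 hθ hc hcop in
/-- **Generator normalisation at `F`-level**: for `p` odd, `U` normal with `p ∤ [Γ_ℚ : U]`
(finite index) and `γ ∈ Gal(ℚ̄/K)` there is `g₀ ∈ ker κ ⊓ Gal(ℚ̄/K)` with `γ g₀ ∈ Gal(ℚ̄/K) ⊓ U` (so `γ g₀`
fixes `F·K`) and `κ (γ g₀) = κ γ`. [folklore] -/
theorem exists_mul_mem_galRange_inf (hp2 : p ≠ 2) {γ : Field.absoluteGaloisGroup ℚ}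
    (hγ : γ ∈ galRange (K := ℚ) K) :
    ∃ g₀ ∈ κ.kerSubgroup ⊓ galRange (K := ℚ) K,
      γ * g₀ ∈ galRange (K := ℚ) K ⊓ U ∧ κ (γ * g₀) = κ γ := by
  have htop := map_galRange_inf_eq_top K h2 hθ hc κ U hcop hp2
  have hmem : κ.toContinuousMonoidHom.toMonoidHom γ ∈
      (galRange (K := ℚ) K ⊓ U).map κ.toContinuousMonoidHom.toMonoidHom := by
    rw [htop]; exact Subgroup.mem_top _
  obtain ⟨m, hm, hκm⟩ := Subgroup.mem_map.mp hmem
  have hker : γ⁻¹ * m ∈ κ.kerSubgroup := by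
    rw [ZpExtension.mem_kerSubgroup, map_mul, map_inv]
    change (κ.toContinuousMonoidHom.toMonoidHom γ)⁻¹ * κ.toContinuousMonoidHom.toMonoidHom m = 1
    rw [hκm, inv_mul_cancel]
  refine ⟨γ⁻¹ * m, Subgroup.mem_inf.mpr ⟨hker, mul_mem (inv_mem hγ) (Subgroup.mem_inf.mp hm).1⟩,
    ?_, ?_⟩
  · rw [mul_inv_cancel_left]; exact hm
  · rw [mul_inv_cancel_left]; exact hκm

variable (V : WeierstrassCurve ℚ) [(galRange (K := ℚ) K).Normal]

include h2 hθ hc hcop in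
/-- **Generator normalisation for eigen dual data**: for `p` odd and `γ ∈ Gal(ℚ̄/K)` there is
`γ' = γ g₀ ∈ Gal(ℚ̄/K) ⊓ U`, `g₀ ∈ ker κ ⊓ Gal(ℚ̄/K)`, with `κ γ' = κ γ` and `γ'_* = γ_*` ON
`chiEigenSelmerIn` (`g₀` acts trivially there: sign `+1`), so that every
`ChiEigenSelmerInDualData V K κ U γ` is one at `γ'` with the same module (`congrGen`). This puts the
generator inside `Gal(ℚ̄/F·K)` — the shape in which the componentwise reading of Kato 17.4 (3) /
Wuthrich Thm. 16 over `F·ℚ_∞ = ℚ(μ_{p^∞})` is stated. [folklore] -/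
theorem exists_normalisedGenerator (hp2 : p ≠ 2) {γ : Field.absoluteGaloisGroup ℚ}
    (hγ : γ ∈ galRange (K := ℚ) K) :
    ∃ γ' ∈ galRange (K := ℚ) K ⊓ U, κ γ' = κ γ ∧ (∃ g₀ ∈ κ.kerSubgroup, γ' = γ * g₀) ∧
      ∀ t : chiEigenSelmerIn V K p κ U,
        V.conjH1 p _ γ' (t : V.subgroupH1 p (κ.kerSubgroup ⊓ galRange (K := ℚ) K ⊓ U)) =
        V.conjH1 p _ γ (t : V.subgroupH1 p (κ.kerSubgroup ⊓ galRange (K := ℚ) K ⊓ U)) := by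
  obtain ⟨g₀, hg₀, hγg₀, hκ⟩ := exists_mul_mem_galRange_inf K h2 hθ hc κ U hcop hp2 hγ
  refine ⟨γ * g₀, hγg₀, hκ, ⟨g₀, hg₀.1, rfl⟩, fun t ↦ ?_⟩
  rw [V.conjH1_mul_holds p, AddMonoidHom.comp_apply, conjH1_eq_self_of_mem_inf hg₀ t.2]

/-- Multiplying a generator by `g₀ ∈ ker κ` keeps `IsTopGenerator`. (additive-p1's
`isTopGenerator_mul_of_mem_kerSubgroup`, restated for `Γ_ℚ`.) [folklore] -/
theorem isTopGenerator_of_kappa_eq {γ γ' : Field.absoluteGaloisGroup ℚ} (h : κ γ' = κ γ)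
    (hγ : κ.IsTopGenerator γ) : κ.IsTopGenerator γ' := by
  rw [ZpExtension.IsTopGenerator, h]; exact hγ

/-- **The cyclotomic-variable normalisation survives**: if `κ` is the cyclotomic `ℤ_p`-extension
then `χ_p(g₀)` is torsion for `g₀ ∈ ker κ = χ_p⁻¹(μ(ℤ_p))`, so `IsCyclotomicVariable p (γ g₀)`
follows from `IsCyclotomicVariable p γ` (`ζ' = ζ·χ_p(g₀)⁻¹`). [cite: Washington1997, §13.1] -/
theorem isCyclotomicVariable_mul_of_mem_kerSubgroup (hκ : κ.IsCyclotomic)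
    {γ g₀ : Field.absoluteGaloisGroup ℚ} (hg₀ : g₀ ∈ κ.kerSubgroup)
    (hγ : IsCyclotomicVariable p γ) : IsCyclotomicVariable p (γ * g₀) := by
  obtain ⟨ζ, hζ, hprod⟩ := hγ
  have htors : g₀ ∈ (CommGroup.torsion ℤ_[p]ˣ).comap
      (GaloisRep.cyclotomicCharacter ℚ p).toMonoidHom := by
    rw [ZpExtension.IsCyclotomic] at hκ
    rw [← hκ]; exact hg₀
  have hfin : IsOfFinOrder (GaloisRep.cyclotomicCharacter ℚ p g₀) := by
    simpa [CommGroup.mem_torsion] using htors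
  refine ⟨ζ * (GaloisRep.cyclotomicCharacter ℚ p g₀)⁻¹, hζ.mul hfin.inv, ?_⟩
  rw [map_mul]
  rw [show GaloisRep.cyclotomicCharacter ℚ p γ * GaloisRep.cyclotomicCharacter ℚ p g₀ *
      (ζ * (GaloisRep.cyclotomicCharacter ℚ p g₀)⁻¹) =
      GaloisRep.cyclotomicCharacter ℚ p γ * ζ by
    rw [mul_comm ζ, ← mul_assoc, mul_assoc (GaloisRep.cyclotomicCharacter ℚ p γ), mul_inv_cancel,
      mul_one]]
  exact hprod

end Gen

/-! ## §5b End to end: every `Λ`-dual datum of `Sel_{p^∞}(E/ℚ_∞)` is an `F`-level eigen datum at a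
generator INSIDE `Gal(ℚ̄/K) ⊓ U`, with the same characteristic ideal -/

section EndToEnd

variable (V : WeierstrassCurve ℚ) (K : Type) [Field K] [NumberField K]
  (h2 : Module.finrank ℚ K = 2) {θ : K} {c : ℚ} (hθ : θ ∉ Set.range (algebraMap ℚ K))
  (hc : θ ^ 2 = algebraMap ℚ K c) (p : ℕ) [Fact p.Prime] (κ : ZpExtension ℚ p)
  [(galRange (K := ℚ) K).Normal] [(V.quadraticTwist c).IsElliptic] [V.IsElliptic]
  {W : WeierstrassCurve ℚ} {C : VariableChange ℚ} (hCW : C • V.quadraticTwist c = W)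
  (U : Subgroup (Field.absoluteGaloisGroup ℚ)) [U.Normal]
  (hU : IsOpen (U : Set (Field.absoluteGaloisGroup ℚ))) (hcop : U.index.Coprime p) (hp2 : p ≠ 2)

include h2 hθ hc hCW hU hcop hp2 in
/-- **[C] + eigen-descent + generator normalisation, packaged.** For `E = E♭ ⊗ χ_K`
(`C • V^{(c)} = W`, `K = ℚ(θ)`, `θ² = c`), `p` odd, `U` open normal with `p ∤ [Γ_ℚ : U]`
(`F = ℚ̄^U`) and ANY `γ ∈ Γ_ℚ`: there are `γ' = γ g` with `g ∈ ker κ` (so `κ γ' = κ γ`, and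
`IsCyclotomicVariable p γ'` if `κ` is cyclotomic and `γ` was), `γ' ∈ Gal(ℚ̄/K) ⊓ U`, and a `Λ`-dual
datum `D'` of `Sel_{p^∞}(E♭/F·K·ℚ_∞)^{(χ_K)}` at `γ'` whose characteristic ideal and torsion-ness
are those of the given `D : W.SelmerDualData κ γ` (indeed `D'.X = D.X`): additive-p1's
`exists_mul_mem_galRange` + `SelmerDualData.congrGen` + `toChiEigen`, then `toIn` +
`exists_normalisedGenerator` + `congrGen`. So a divisibility proved for every such `D'` — the
componentwise reading of Kato 17.4 (3) / Wuthrich Thm. 16 over `F·ℚ_∞` — is a divisibility in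
`char_Λ X(E/ℚ_∞)`. [cite: GreenbergLNM1716, §5 p. 143] -/
theorem SelmerDualData.exists_chiEigenIn {γ : Field.absoluteGaloisGroup ℚ} (D : W.SelmerDualData κ γ) :
    ∃ γ' : Field.absoluteGaloisGroup ℚ, γ' ∈ galRange (K := ℚ) K ⊓ U ∧ κ γ' = κ γ ∧
      (∃ g ∈ κ.kerSubgroup, γ' = γ * g) ∧
      ∃ D' : ChiEigenSelmerInDualData V K κ U γ',
        Literature.NumberTheory.EllipticCurves.Module.charIdeal (IwasawaAlgebra p) D'.X = D.charIdeal ∧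
          (Module.IsTorsion (IwasawaAlgebra p) D'.X ↔ D.IsTorsion) := by
  -- step 1 (additive-p1): move `γ` into `Gal(ℚ̄/K)` by `g₀ ∈ ker κ`, same action on `H¹(ℚ_∞, E[p^∞])`
  obtain ⟨g₀, hg₀, hγ₀K, hconj₀, hκ₀⟩ := exists_mul_mem_galRange W K h2 hθ hc κ hp2 γ
  let D₀ : W.SelmerDualData κ (γ * g₀) := SelmerDualData.congrGen W κ hconj₀ D
  -- step 2: [C] then the eigen-descent, same module
  let D₁ : ChiEigenSelmerInDualData V K κ U (γ * g₀) :=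
    SelmerDualData.toChiEigenIn V K h2 hθ hc p κ hCW U hU hcop hp2 hγ₀K D₀
  -- step 3: move `γ g₀` into `Gal(ℚ̄/K) ⊓ U` by `g₁ ∈ ker κ ⊓ Gal(ℚ̄/K)`, same action on the eigenspace
  obtain ⟨γ', hγ'KU, hκ', ⟨g₁, hg₁, hγ'⟩, hact⟩ :=
    exists_normalisedGenerator K h2 hθ hc κ U hcop V hp2 hγ₀K
  refine ⟨γ', hγ'KU, hκ'.trans hκ₀, ⟨g₀ * g₁, mul_mem hg₀ hg₁, by rw [hγ', mul_assoc]⟩,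
    ChiEigenSelmerInDualData.congrGen hact D₁, rfl, Iff.rfl⟩

/-- The normalisations of `SelmerDualData.exists_chiEigenIn` keep `IsTopGenerator`. [folklore] -/
theorem isTopGenerator_of_kappa_eq' {γ γ' : Field.absoluteGaloisGroup ℚ} (h : κ γ' = κ γ)
    (hγ : κ.IsTopGenerator γ) : κ.IsTopGenerator γ' :=
  isTopGenerator_of_kappa_eq κ h hγ

/-- … and keep `IsCyclotomicVariable p` when `κ` is cyclotomic. [cite: Washington1997, §13.1] -/
theorem isCyclotomicVariable_of_eq_mul (hκ : κ.IsCyclotomic) {γ γ' g : Field.absoluteGaloisGroup ℚ}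
    (hg : g ∈ κ.kerSubgroup) (h : γ' = γ * g) (hγ : IsCyclotomicVariable p γ) :
    IsCyclotomicVariable p γ' := by
  rw [h]; exact isCyclotomicVariable_mul_of_mem_kerSubgroup κ hκ hg hγ

end EndToEnd

/-! ## §6 The cyclotomic case `U = Gal(ℚ̄/ℚ(ζ_p))`: index `p − 1`, prime to `p` -/

section Cyclotomic

variable (p : ℕ) [hp : Fact p.Prime] (F : Type) [Field F] [NumberField F]
  [hF : IsCyclotomicExtension {p} ℚ F]

omit hp in
include hF in
/-- `galRange F` is normal in `Γ_ℚ` for `F = ℚ(ζ_p)` (Galois). [folklore] -/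
theorem normal_galRange_cyclotomic : (galRange (K := ℚ) F).Normal := by
  haveI : IsGalois ℚ F := IsCyclotomicExtension.isGalois {p} ℚ F
  exact RelModel.normal_galRange F

/-- `[Γ_ℚ : galRange F] = [ℚ(ζ_p) : ℚ] = p − 1`. [folklore] -/
theorem index_galRange_cyclotomic : (galRange (K := ℚ) F).index = p - 1 := by
  haveI : IsGalois ℚ F := IsCyclotomicExtension.isGalois {p} ℚ F
  rw [RelModel.index_galRange F,
    IsCyclotomicExtension.finrank F (Polynomial.cyclotomic.irreducible_rat hp.out.pos),
    Nat.totient_prime hp.out]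

/-- `p ∤ [Γ_ℚ : galRange F] = p − 1`. [folklore] -/
theorem coprime_index_galRange_cyclotomic : (galRange (K := ℚ) F).index.Coprime p := by
  rw [index_galRange_cyclotomic p F]
  exact (Nat.coprime_self_sub_left hp.out.one_lt.le).mpr (Nat.coprime_one_left p)

variable (V : WeierstrassCurve ℚ) (K : Type) [Field K] [NumberField K]
  (h2 : Module.finrank ℚ K = 2) {θ : K} {c : ℚ} (hθ : θ ∉ Set.range (algebraMap ℚ K))
  (hc : θ ^ 2 = algebraMap ℚ K c) (κ : ZpExtension ℚ p)
  [(galRange (K := ℚ) K).Normal] [(V.quadraticTwist c).IsElliptic] [V.IsElliptic]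
  {W : WeierstrassCurve ℚ} {C : VariableChange ℚ} (hCW : C • V.quadraticTwist c = W) (hp2 : p ≠ 2)

include h2 hθ hc hCW hp2 in
/-- **The cyclotomic case, end to end.** For `E = E♭ ⊗ χ_K` (`C • V^{(c)} = W`, `K = ℚ(θ)`,
`θ² = c`; meant: `c = p*`, `K = ℚ(√p*) ⊂ F`), `p` odd, `F = ℚ(ζ_p)` and ANY `γ ∈ Γ_ℚ`: with
`[galRange F.Normal]` supplied by `normal_galRange_cyclotomic`, there are `γ' = γ g`, `g ∈ ker κ`
(`κ γ' = κ γ`), `γ' ∈ Gal(ℚ̄/K) ⊓ Gal(ℚ̄/F)`, and a `Λ`-dual datum `D'` of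
`Sel_{p^∞}(E♭/F·K·ℚ_∞)^{(χ_K)}` — for `K ⊂ F`: of `e_{(p−1)/2}·Sel_{p^∞}(E♭/ℚ(μ_{p^∞}))` — at `γ'`
with `char_Λ D'.X = char_Λ X(E/ℚ_∞)` and the same torsion-ness as the given `D : W.SelmerDualData κ γ`.
This is the exact input slot of the componentwise reading of Kato 2004 Thm. 17.4 (3) / Wuthrich 2014
Thm. 16 over `ℚ(μ_{p^∞})` at EVERY odd `p` (at `p = 3`, `F = K`). [cite: GreenbergLNM1716, §5 p. 143] -/
theorem SelmerDualData.exists_chiEigenInCyclotomic [(galRange (K := ℚ) F).Normal]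
    {γ : Field.absoluteGaloisGroup ℚ} (D : W.SelmerDualData κ γ) :
    ∃ γ' : Field.absoluteGaloisGroup ℚ, γ' ∈ galRange (K := ℚ) K ⊓ galRange (K := ℚ) F ∧ κ γ' = κ γ ∧
      (∃ g ∈ κ.kerSubgroup, γ' = γ * g) ∧
      ∃ D' : ChiEigenSelmerInDualData V K κ (galRange (K := ℚ) F) γ',
        Literature.NumberTheory.EllipticCurves.Module.charIdeal (IwasawaAlgebra p) D'.X = D.charIdeal ∧
          (Module.IsTorsion (IwasawaAlgebra p) D'.X ↔ D.IsTorsion) :=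
  SelmerDualData.exists_chiEigenIn V K h2 hθ hc p κ hCW (galRange (K := ℚ) F) (isOpen_galRange F)
    (coprime_index_galRange_cyclotomic p F) hp2 D

end Cyclotomic

end Summit.BirchSwinnertonDyer.Rank1Residual.Additive

end
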